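import Mathlib
import HarnessLib
import Summits.CriticalPhenomena.PercolationContinuityZ3.Theses.PercLowPointHalfSpace
import Summits.CriticalPhenomena.PercolationContinuityZ3.Theorems.PercLowPointHalfSpaceAssemblyColumnTelescoping
import Literature.Probability.Percolation.UniversalTightness

/-!
# Crux-ideate sketch (round 1, ideator 2) for `LowPointBookkeeping` (stmt-CriticalPhenomena-14713)

First lemmas / transferred statements of the two crux idea cards of this seat:

* card `holder-tightness-decoupling`:
  `WindowAverageDecay` (window-averaged form of the conclusion) and the PROVED reduction
  `lowPointBookkeeping_of_windowAverageDecay : WindowAverageDecay → LowPointBookkeeping`;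
  the one-cluster inputs `NoFatHalfBox` (B♯, typical largest cluster in a half-box),
  `TallMassMoments` (B_q, all conditional moments), `PointwiseWallTwoPoint` (PW, pointwise form of B),
  `BoundaryTwoArmPoly` (A_poly, root-distance-uniform form of A), `BoundaryTwoArmSharp` (A♯, a₂ > 11/4);
  the abstract Hölder step `holder_two_bush` (measure theory, PROVED from Mathlib).
* card `arm-conditioned-bhk`:
  `DisjointnessDoesNotFatten` (AB) and its bilinear form `ArmConditionedBHK` (AB₂).
-/

noncomputable section

open scoped Classical

namespace Summit.CriticalPhenomena.PercolationContinuityZ3.Cruxes.LowPointBookkeeping.Ideas2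

open MeasureTheory Finset Filter Topology
open Literature.Probability.LatticeModels Literature.Probability.Percolation
open Summit.CriticalPhenomena.PercolationContinuityZ3.Theses.PercLowPointHalfSpace

/-- The critical bond-percolation measure on `ℤ³`. -/
abbrev μc : Measure (BondConfig (Site 3)) := bondPercolation (zdGraph 3) (criticalProbI 3)

/-- The closed upper half-space `ℍ = {x₀ ≥ 0}`. -/
abbrev HS : Set (Site 3) := {x : Site 3 | 0 ≤ x 0}

/-- `arm_ℍ(x,r)`: the half-space cluster of `x` reaches sup-distance `≥ r` from `x`
(for `x = 0` verbatim the event of the route decls). -/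
abbrev tallAt (x : Site 3) (r : ℕ) : Set (BondConfig (Site 3)) :=
  {ω | ∃ y : Site 3, (∃ i : Fin 3, (r : ℤ) ≤ |y i - x i|) ∧ ω ∈ openConnIn HS x y}

/-- `arm_ℍ(0,r)`. -/
abbrev tall (r : ℕ) : Set (BondConfig (Site 3)) :=
  {ω | ∃ y : Site 3, (∃ i : Fin 3, (r : ℤ) ≤ |y i|) ∧ ω ∈ openConnIn HS 0 y}

/-- `{0 ↔_ℍ x}`. -/
abbrev conn (x : Site 3) : Set (BondConfig (Site 3)) := openConnIn HS 0 x

/-- The adjacent floor root `e = (0,1,0)` of the route's crux A. -/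
abbrev eRoot : Site 3 := Pi.single 1 1

/-- Mass of the half-space cluster of `0` inside the sup-ball `B_r`: `|U ∩ B_r|` (a random natural
number; the box is a `Finset`, so this is a finite cardinality). -/
def massIn (r : ℕ) (ω : BondConfig (Site 3)) : ℕ :=
  ((box 3 r).filter fun x => ω ∈ conn x).card

/-! ### Card `holder-tightness-decoupling` -/

/-- The window `W_L = {w : L ≤ w₀ ≤ 2L, |w₁|,|w₂| ≤ 2L}` (as a subset of the box `B_{2L}`). -/
def window (L : ℕ) : Finset (Site 3) := (box 3 (2 * L)).filter fun w => (L : ℤ) ≤ w 0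

/-- **Window-averaged decay** of the bulk two-point function at `p_c(ℤ³)`:
`(1/|W_L|) Σ_{w ∈ W_L} P_{p_c}(0 ↔ w) → 0`. By `θ² ≤ τ(0,w)` for EVERY `w` this already gives
`θ(p_c) = 0`, hence (conjunct → K) the crux; it is the form in which the cross-bush term becomes a
MASS PRODUCT of two bushes (crux B is a box sum: no pointwise density needed at the window scale). -/
def WindowAverageDecay : Prop :=
  Tendsto (fun L : ℕ => (∑ w ∈ window L, μc.real (openConn (0 : Site 3) w)) / ((window L).card : ℝ))
    atTop (𝓝 0)

/-- **B♯ — no fat cluster in a half-box** (typical-largest-cluster form of crux B): for some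
`ε > 0`, `δ ≥ 0`, with probability `≥ ε` NO half-space cluster has `≥ r^{11/4+δ}` vertices in
`B_r ∩ ℍ`, uniformly in `r`. With Hutchcroft's universal tightness (tree:
`prodBernoulli_real_clusterCapIn_ge_mul_le`) it gives ALL moments `E|U ∩ B_r|^q ≤ C_q r^{q(11/4+δ)}`
and the same for every `r`-window of a larger cluster. -/
def NoFatHalfBox : Prop :=
  ∃ ε δ : ℝ, 0 < ε ∧ 0 ≤ δ ∧ ∀ r : ℕ, 1 ≤ r →
    μc.real {ω | ∃ v : Site 3, 0 ≤ v 0 ∧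
      (r : ℝ) ^ ((11 : ℝ) / 4 + δ) ≤ (((box 3 r).filter fun x => ω ∈ openConnIn HS v x).card : ℝ)}
      ≤ 1 - ε

/-- **B♯ for all half-space windows** (the form the deep regime of the Hölder line uses: the
window `B_L(z) ∩ ℍ` at any position `z ∈ ℍ`; for `z = 0` it is `NoFatHalfBox`). CAVEAT recorded on
the card: as `z₀ → ∞` this approaches the BULK no-fat-box statement, whose bulk version implies
`θ(p_c) = 0` by the spatial ergodic theorem (costume-adjacent); the `ℍ`-cluster version is not
known to. -/
def NoFatHalfBoxWindows : Prop :=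
  ∃ ε δ : ℝ, 0 < ε ∧ 0 ≤ δ ∧ ∀ L : ℕ, 1 ≤ L → ∀ z : Site 3, 0 ≤ z 0 →
    μc.real {ω | ∃ v : Site 3, 0 ≤ v 0 ∧
      (L : ℝ) ^ ((11 : ℝ) / 4 + δ) ≤
        (((box 3 L).filter fun x => ω ∈ openConnIn HS v (z + x)).card : ℝ)} ≤ 1 - ε

/-- **B_q — all conditional moments of the tall-cluster mass** (moment form of crux B):
`E[|U ∩ B_r|^q ; arm_ℍ(0,r)] ≤ C_q r^{11q/4} P(arm_ℍ(0,r))` for every `q ≥ 1`. -/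
def TallMassMoments : Prop :=
  ∀ q : ℕ, 1 ≤ q → ∃ C : ℝ, ∀ r : ℕ, 1 ≤ r →
    ∫ ω, ((massIn r ω : ℝ) ^ q) * (tall r).indicator (fun _ => (1 : ℝ)) ω ∂μc
      ≤ C * (r : ℝ) ^ ((11 : ℝ) * q / 4) * μc.real (tall r)

/-- **PW — pointwise wall two-point bound** (pointwise form of crux B, gap G3):
`P(0 ↔_ℍ x) ≤ C ‖x‖_∞^{-1/4} · P(arm_ℍ(0, ⌊‖x‖_∞/2⌋))` (true decay `‖x‖^{-(x_s+x_h)} ≈ ‖x‖^{-1.45}`,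
asked `‖x‖^{-1/4-a}`; margin ≥ 1.2). Needed only in the deep regime of the Hölder line with A as typed. -/
def PointwiseWallTwoPoint : Prop :=
  ∃ C : ℝ, ∀ x : Site 3, ∀ n : ℕ, 2 ≤ n → (∀ i : Fin 3, |x i| ≤ n) → (∃ i : Fin 3, (n : ℤ) ≤ |x i|) →
    μc.real (conn x) ≤ C * (n : ℝ) ^ (-(1 : ℝ) / 4) * μc.real (tall (n / 2))

/-- **A_poly — boundary two-arm repulsion, uniformly polynomial in the root distance** (gap G1):
`P(arm_ℍ(0,r), arm_ℍ(x,r), 0 ↮_ℍ x) ≤ C (1+‖x‖)^{C'} r^{-5/2-κ}` for every floor point `x`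
(A is the case `x = e`; believed `ℓ^{a₂-2x_s} ≈ ℓ^{1.05}`). -/
def BoundaryTwoArmPoly : Prop :=
  ∃ κ C C' : ℝ, 0 < κ ∧ ∀ x : Site 3, x 0 = 0 → x ≠ 0 → ∀ ℓ : ℕ, (∀ i : Fin 3, |x i| ≤ ℓ) →
    ∀ r : ℕ, 1 ≤ r →
      μc.real (tall r ∩ tallAt x r ∩ (openConnIn HS 0 x)ᶜ) ≤
        C * (1 + (ℓ : ℝ)) ^ C' * (r : ℝ) ^ (-(5 / 2 + κ))

/-- **A♯ — boundary two-arm exponent above `11/4`** (variant (ii) of the Hölder line: with it the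
deep regime needs neither PW nor BHK; the saturation-forced value is `a₂ = 3`, MC 2.9–3.1). -/
def BoundaryTwoArmSharp : Prop :=
  ∃ κ C : ℝ, 0 < κ ∧ ∀ r : ℕ, 1 ≤ r →
    μc.real (tall r ∩ tallAt eRoot r ∩ (openConnIn HS 0 eRoot)ᶜ) ≤ C * (r : ℝ) ^ (-(11 / 4 + κ))

/-- **The Hölder step of the line, abstractly** (three-function Hölder with exponents
`(q/(q-2), q, q)`; here stated with `q = 2k`, `k ≥ 2`, in the squared-free form used by the
bookkeeping): `∫ 1_A f g ≤ μ(A)^{1-1/k} (∫ f^{2k})^{1/(2k)} (∫ g^{2k})^{1/(2k)}` for nonnegative `f, g`.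
Keeps the fraction `1 - 1/k` of the two-arm exponent while asking only one-cluster moments. -/
def HolderTwoBushStatement : Prop :=
  ∀ (μ : Measure (BondConfig (Site 3))) [IsProbabilityMeasure μ] (A : Set (BondConfig (Site 3)))
    (f g : BondConfig (Site 3) → ℝ) (k : ℕ), 2 ≤ k → MeasurableSet A → Measurable f → Measurable g →
    (∀ ω, 0 ≤ f ω) → (∀ ω, 0 ≤ g ω) → Integrable (fun ω => f ω ^ (2 * k)) μ →
    Integrable (fun ω => g ω ^ (2 * k)) μ →
      ∫ ω, A.indicator (fun _ => (1 : ℝ)) ω * (f ω * g ω) ∂μ ≤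
        μ.real A ^ (1 - 1 / (k : ℝ)) * (∫ ω, f ω ^ (2 * k) ∂μ) ^ (1 / (2 * k : ℝ)) *
          (∫ ω, g ω ^ (2 * k) ∂μ) ^ (1 / (2 * k : ℝ))

/-! ### Card `arm-conditioned-bhk` -/

/-- The route's crux-A event: two DISJOINT half-space clusters from the adjacent roots `0, e`,
the one from `0` reaching sup-distance `h`, the one from `e` reaching `N` (asymmetric heights). -/
abbrev twoArm (h N : ℕ) : Set (BondConfig (Site 3)) :=
  tall h ∩ tallAt eRoot N ∩ (openConnIn HS 0 eRoot)ᶜ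

/-- **(AB) Disjointness does not fatten.** Conditioned on the two-arm event, the mass of the
`h`-tall cluster is at most `C h^{11/4}` on average — crux B's bound SURVIVES the extra conditioning
on a disjoint tall neighbour: `E[|U ∩ B_h| ; twoArm h N] ≤ C h^{11/4} P(twoArm h N)`.
(2D analogue: separation of arms; MC kit j015398: ratio E[M|G]/E[M|tall] = 0.684, 0.687, 0.686 at r = 16, 24, 32.) -/
def DisjointnessDoesNotFatten : Prop :=
  ∃ C : ℝ, ∀ h N : ℕ, 1 ≤ h → 1 ≤ N →
    ∫ ω, (massIn h ω : ℝ) * (twoArm h N).indicator (fun _ => (1 : ℝ)) ω ∂μc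
      ≤ C * (h : ℝ) ^ ((11 : ℝ) / 4) * μc.real (twoArm h N)

/-- Mass of the half-space cluster of the root `e` in a sup-ball of radius `L` around `z`. -/
def massAtIn (z : Site 3) (L : ℕ) (ω : BondConfig (Site 3)) : ℕ :=
  ((box 3 L).filter fun x => ω ∈ openConnIn HS eRoot (z + x)).card

/-- **(AB₂) Arm-conditioned BHK** (the bilinear decorrelation the exact frozen-bush factorisation
needs): given the two-arm event, the product (mass of the `h`-cluster) × (mass of the `N`-cluster
in ANY `L`-window at height ≥ N/4) is bounded by the product of the one-arm conditional bounds,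
the second in DENSITY form `L³ N^{11/4-3}`:
`E[|U₀ ∩ B_h| · |U_e ∩ B_L(z)| ; twoArm h N] ≤ C h^{11/4} (L³ N^{-1/4}) P(twoArm h N)`.
Van den Berg–Häggström–Kahn (RSA 2006, Thm 1.4) prove the `C = 1` negative correlation of
increasing functions of the two clusters given ONLY `0 ↮ e`; the bet is that it survives the arm
conditioning up to a constant (true in 2D by arm separation). -/
def ArmConditionedBHK : Prop :=
  ∃ C : ℝ, ∀ h N L : ℕ, 1 ≤ h → 1 ≤ L → 4 * L ≤ N → ∀ z : Site 3, (N : ℤ) ≤ 4 * z 0 →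
    ∫ ω, ((massIn h ω : ℝ) * (massAtIn z L ω : ℝ)) * (twoArm h N).indicator (fun _ => (1 : ℝ)) ω ∂μc
      ≤ C * (h : ℝ) ^ ((11 : ℝ) / 4) * ((L : ℝ) ^ (3 : ℝ) * (N : ℝ) ^ (-(1 : ℝ) / 4)) *
          μc.real (twoArm h N)

/-! ### Proved reductions -/

/-- `θ(p_c)² · |W_L| ≤ Σ_{w ∈ W_L} τ_{p_c}(0,w)` — `θ² ≤ τ` termwise
(`Grimmett1999_theta_sq_le_openConn_holds`). -/
theorem theta_sq_mul_card_le_windowSum (L : ℕ) :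
    theta (zdGraph 3) (0 : Site 3) (criticalProbI 3) ^ 2 * ((window L).card : ℝ) ≤
      ∑ w ∈ window L, μc.real (openConn (0 : Site 3) w) := by
  rw [mul_comm, ← nsmul_eq_mul, ← Finset.sum_const]
  exact Finset.sum_le_sum fun w _ =>
    Grimmett1999_theta_sq_le_openConn_holds 3 (criticalProbI 3) 0 w

/-- The window is nonempty: it contains `L e₀`… in fact `(2L) e₀`-type points; we use `w = L e₀`. -/
theorem window_nonempty (L : ℕ) : (window L).Nonempty := by
  refine ⟨Pi.single 0 (L : ℤ), ?_⟩
  simp only [window, Finset.mem_filter, mem_box, Pi.single_apply]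
  refine ⟨fun i => ?_, by simp⟩
  split_ifs <;> constructor <;> push_cast <;> omega

/-- **Window-averaged decay ⟹ `θ(p_c(ℤ³)) = 0`.** -/
theorem percolationContinuityZ3_of_windowAverageDecay (h : WindowAverageDecay) :
    _root_.PercolationContinuityZ3 := by
  show theta (zdGraph 3) (0 : Site 3) (criticalProbI 3) = 0
  set θ := theta (zdGraph 3) (0 : Site 3) (criticalProbI 3) with hθ
  have hle : ∀ L : ℕ, θ ^ 2 ≤
      (∑ w ∈ window L, μc.real (openConn (0 : Site 3) w)) / ((window L).card : ℝ) := by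
    intro L
    have hc : (0 : ℝ) < ((window L).card : ℝ) := by
      exact_mod_cast Finset.card_pos.mpr (window_nonempty L)
    rw [le_div_iff₀ hc]
    exact theta_sq_mul_card_le_windowSum L
  have hsq : θ ^ 2 ≤ 0 := ge_of_tendsto' h hle
  exact pow_eq_zero_iff two_ne_zero |>.1 (le_antisymm hsq (sq_nonneg _))

/-- **Window-averaged decay ⟹ the crux** (`conjunct → K`: the conclusion of K follows from
`θ(p_c) = 0` through the tree's column-sum equivalence). -/
theorem lowPointBookkeeping_of_windowAverageDecay (h : WindowAverageDecay) :
    LowPointBookkeeping := by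
  intro _ _ _
  have hcont := percolationContinuityZ3_of_windowAverageDecay h
  -- τ(0, n e₀) = τ_ℍ(0, n e₀) + column sum; both tend to 0 under the conjunct.
  have hcol := (Theorems.percolationContinuityZ3_iff_tendsto_columnSum).1 hcont
  have hfloor := Theorems.LowPoint.tendsto_measure_openConnIn_halfSpace_axis
  -- assemble in ℝ≥0∞ and pass to .real
  have hsum : Tendsto (fun n : ℕ => bondPercolation (zdGraph 3) (criticalProbI 3)
      (openConn (0 : Site 3) (Pi.single 0 (n : ℤ)))) atTop (𝓝 0) := by
    have key : ∀ n : ℕ, bondPercolation (zdGraph 3) (criticalProbI 3)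
        (openConn (0 : Site 3) (Pi.single 0 (n : ℤ))) =
        bondPercolation (zdGraph 3) (criticalProbI 3)
          (openConnIn {x : Site 3 | 0 ≤ x 0} 0 (Pi.single 0 (n : ℤ))) +
        ∑' t : ℕ, bondPercolation (zdGraph 3) (criticalProbI 3)
          (openConnIn {x : Site 3 | 0 ≤ x 0} (Pi.single 0 ((t : ℤ) + 1))
              (Pi.single 0 ((n : ℤ) + (t : ℤ) + 1)) \
            openConnIn {x : Site 3 | 1 ≤ x 0} (Pi.single 0 ((t : ℤ) + 1))
              (Pi.single 0 ((n : ℤ) + (t : ℤ) + 1))) := by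
      intro n
      rw [Theorems.LowPoint.measure_openConn_eq_column_add_tsum (criticalProbI 3)
        (Pi.single 0 (n : ℤ))]
      congr 1
      refine tsum_congr fun t => ?_
      rw [Theorems.LowPoint.single_add_single_succ]
    simp_rw [key]
    simpa using hfloor.add hcol
  have h2 := (ENNReal.tendsto_toReal ENNReal.zero_ne_top).comp hsum
  rw [ENNReal.toReal_zero] at h2
  exact h2

end Summit.CriticalPhenomena.PercolationContinuityZ3.Cruxes.LowPointBookkeeping.Ideas2

end
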